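import Mathlib.Analysis.SpecialFunctions.OrdinaryHypergeometric
import Mathlib.Analysis.Calculus.SmoothSeries
import Mathlib.Analysis.Calculus.Deriv.Inv
import Mathlib.Analysis.Calculus.Deriv.Mul
import Mathlib.Analysis.SpecificLimits.Normed
import HarnessLib

/-!
# Parameter-derivative of the Miller–Werner hypergeometric factor `₂F₁(a, 1-a; 2a; x)`

The `CLE_κ` hook-up probability of Miller–Werner (Comm. Math. Phys. 362 (2018), §4) involves
`f_κ(x) = ₂F₁(4/κ, 1-4/κ; 8/κ; x)`, i.e. the one-parameter family `₂F₁(a, 1-a; 2a; x)` with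
`a = 4/κ`; `κ ∈ (8/3, 8)` corresponds to `a ∈ (1/2, 3/2)`. Route statements of
`Summits/CriticalPhenomena/CardyFormulaZ2` differentiate the hook-up probability in `κ` at
`κ = 6` (to express `q`-derivatives of FK crossing probabilities at percolation), which needs
differentiability of `κ ↦ f_κ(x)` for fixed `x` — a parameter-derivative of the Gauss series
that Mathlib does not provide. This file proves it by term-wise differentiation:

* the Gauss coefficient of `xⁿ` is `t_n(a) = ∏_{j<n} φ_j(a)` with
  `φ_j(a) = (a+j)(1-a+j)/((2a+j)(j+1))` (`mwRatio`, `mwCoeff`, `mwCoeff_eq_coeff`);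
* for `a ∈ (1/2, 3/2)`: `|φ_j| ≤ 1`, `|φ_j'| ≤ 4`, hence `|t_n| ≤ 1`, `|t_n'| ≤ 4n` (Leibniz);
* `hasDerivAt_tsum_of_isPreconnected` with the summable bound `4 n |x|ⁿ` gives
  `hasDerivAt_hypergeometric_mwParam` (`|x| < 1`, `a ∈ (1/2, 3/2)`), and composing with
  `a = 4/κ` gives `differentiableAt_hypergeometric_mw` (`κ ∈ (8/3, 8)`).

Elementary real analysis; no named facts. [folklore] throughout; the family is that of
Miller–Werner 2018, §4.
-/

noncomputable section

namespace Literature.Probability.RandomPlanarGeometry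

open Real Set Finset

/-! ### The coefficient ratio `φ_n(a) = (a+n)(1-a+n)/((2a+n)(n+1))` -/

/-- The ratio of consecutive Gauss coefficients of `f = ₂F₁(a, 1-a; 2a; ·)`:
`φ_n(a) = (a+n)(1-a+n) / ((2a+n)(n+1))`. [folklore] -/
def mwRatio (n : ℕ) (a : ℝ) : ℝ :=
  (a + n) * (1 - a + n) / ((2 * a + n) * (n + 1))

/-- The `a`-derivative of `mwRatio n` (quotient rule):
`φ_n'(a) = ((1-2a)(2a+n)(n+1) - 2(a+n)(1-a+n)(n+1)) / ((2a+n)(n+1))²`. [folklore] -/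
def mwRatioDeriv (n : ℕ) (a : ℝ) : ℝ :=
  ((1 - 2 * a) * ((2 * a + n) * (n + 1)) - (a + n) * (1 - a + n) * (2 * (n + 1))) /
    ((2 * a + n) * (n + 1)) ^ 2

/-- `φ_n` is differentiable in `a` wherever `2a + n ≠ 0`, with derivative `mwRatioDeriv n a`.
[folklore] -/
theorem hasDerivAt_mwRatio (n : ℕ) {a : ℝ} (ha : 2 * a + n ≠ 0) :
    HasDerivAt (mwRatio n) (mwRatioDeriv n a) a := by
  have hN : HasDerivAt (fun a : ℝ => (a + n) * (1 - a + n))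
      (1 * (1 - a + n) + (a + n) * (-1)) a :=
    ((hasDerivAt_id' a).add_const (n : ℝ)).mul (((hasDerivAt_id' a).const_sub 1).add_const (n : ℝ))
  have hD : HasDerivAt (fun a : ℝ => (2 * a + n) * (n + 1)) (2 * 1 * (n + 1)) a :=
    (((hasDerivAt_id' a).const_mul 2).add_const (n : ℝ)).mul_const ((n : ℝ) + 1)
  have hD0 : (2 * a + n) * ((n : ℝ) + 1) ≠ 0 := mul_ne_zero ha (by positivity)
  refine (hN.div hD hD0).congr_deriv ?_
  unfold mwRatioDeriv
  ring

/-- For `a ∈ (1/2, 3/2)`: `|(a+n)(1-a+n)| ≤ (2a+n)(n+1)`, i.e. `|φ_n(a)| ≤ 1`. [folklore] -/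
theorem abs_mwRatio_num_le (n : ℕ) {a : ℝ} (ha : a ∈ Ioo (1 / 2 : ℝ) (3 / 2)) :
    |(a + n) * (1 - a + n)| ≤ (2 * a + n) * (n + 1) := by
  have hn : (0 : ℝ) ≤ n := n.cast_nonneg
  rw [abs_le]
  constructor <;> nlinarith [ha.1, ha.2]

/-- For `a ∈ (1/2, 3/2)` the denominator `(2a+n)(n+1)` is at least `n + 1 ≥ 1`. [folklore] -/
theorem mwRatio_den_ge (n : ℕ) {a : ℝ} (ha : a ∈ Ioo (1 / 2 : ℝ) (3 / 2)) :
    (n : ℝ) + 1 ≤ (2 * a + n) * (n + 1) := by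
  have hn : (0 : ℝ) ≤ n := n.cast_nonneg
  nlinarith [ha.1]

/-- `|φ_n(a)| ≤ 1` for `a ∈ (1/2, 3/2)`. [folklore] -/
theorem abs_mwRatio_le_one (n : ℕ) {a : ℝ} (ha : a ∈ Ioo (1 / 2 : ℝ) (3 / 2)) :
    |mwRatio n a| ≤ 1 := by
  have hn : (0 : ℝ) ≤ n := n.cast_nonneg
  have hD : 0 < (2 * a + n) * ((n : ℝ) + 1) := lt_of_lt_of_le (by positivity) (mwRatio_den_ge n ha)
  rw [mwRatio, abs_div, abs_of_pos hD, div_le_one hD]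
  exact abs_mwRatio_num_le n ha

/-- `|φ_n'(a)| ≤ 4` for `a ∈ (1/2, 3/2)`. [folklore] -/
theorem abs_mwRatioDeriv_le (n : ℕ) {a : ℝ} (ha : a ∈ Ioo (1 / 2 : ℝ) (3 / 2)) :
    |mwRatioDeriv n a| ≤ 4 := by
  have hn : (0 : ℝ) ≤ n := n.cast_nonneg
  set D := (2 * a + n) * ((n : ℝ) + 1) with hDdef
  set N := (a + n) * (1 - a + (n : ℝ)) with hNdef
  have hD1 : (n : ℝ) + 1 ≤ D := mwRatio_den_ge n ha
  have hD : 0 < D := lt_of_lt_of_le (by positivity) hD1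
  have hN : |N| ≤ D := abs_mwRatio_num_le n ha
  have h12 : |1 - 2 * a| ≤ 2 := by
    rw [abs_le]
    constructor <;> linarith [ha.1, ha.2]
  have hnum : |(1 - 2 * a) * D - N * (2 * (n + 1))| ≤ 2 * D * (n + 2) := by
    calc |(1 - 2 * a) * D - N * (2 * (n + 1))|
        ≤ |(1 - 2 * a) * D| + |N * (2 * (n + 1))| := abs_sub _ _
      _ = |1 - 2 * a| * D + |N| * (2 * (n + 1)) := by
          rw [abs_mul (1 - 2 * a) D, abs_mul N, abs_of_pos hD,
            abs_of_pos (by positivity : (0 : ℝ) < 2 * (n + 1))]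
      _ ≤ 2 * D + D * (2 * (n + 1)) := by gcongr
      _ = 2 * D * (n + 2) := by ring
  rw [mwRatioDeriv, ← hDdef, ← hNdef, abs_div, abs_of_pos (by positivity : (0 : ℝ) < D ^ 2),
    div_le_iff₀ (by positivity : (0 : ℝ) < D ^ 2)]
  calc |(1 - 2 * a) * D - N * (2 * (↑n + 1))|
      ≤ 2 * D * (n + 2) := hnum
    _ ≤ 4 * D ^ 2 := by nlinarith [hD1, hD]

/-! ### The coefficients `t_n(a) = ∏_{j<n} φ_j(a)` and their derivatives -/

/-- The Gauss coefficients of `f = ₂F₁(a, 1-a; 2a; ·)` in product form `t_n(a) = ∏_{j<n} φ_j(a)`.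
[folklore] -/
def mwCoeff (n : ℕ) (a : ℝ) : ℝ := ∏ j ∈ range n, mwRatio j a

/-- The `a`-derivative of `mwCoeff n` (Leibniz rule for a finite product). [folklore] -/
def mwCoeffDeriv (n : ℕ) (a : ℝ) : ℝ :=
  ∑ i ∈ range n, (∏ j ∈ (range n).erase i, mwRatio j a) • mwRatioDeriv i a

/-- `t_n(a)` is Mathlib's `ordinaryHypergeometricCoefficient a (1-a) (2a) n` (the recursion
`(α)_{n+1} = (α)_n (α+n)`, `(n+1)! = (n+1) n!`; valid for all real `a` with Mathlib's `0⁻¹ = 0`).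
[folklore] -/
theorem mwCoeff_eq_coeff (n : ℕ) (a : ℝ) :
    mwCoeff n a = ordinaryHypergeometricCoefficient a (1 - a) (2 * a) n := by
  induction n with
  | zero => simp [mwCoeff, ordinaryHypergeometricCoefficient]
  | succ n ih =>
    rw [mwCoeff, prod_range_succ, ← mwCoeff, ih]
    unfold ordinaryHypergeometricCoefficient mwRatio
    rw [ascPochhammer_succ_eval, ascPochhammer_succ_eval, ascPochhammer_succ_eval,
      Nat.factorial_succ, Nat.cast_mul, Nat.cast_succ]
    simp only [mul_inv, div_eq_mul_inv]
    ring

/-- `₂F₁(a, 1-a; 2a; x) = Σ t_n(a) xⁿ` for all real `a, x` (Mathlib junk conventions agree).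
[folklore] -/
theorem hypergeometric_mw_eq_tsum (a x : ℝ) :
    ₂F₁ a (1 - a) (2 * a) x = ∑' n : ℕ, mwCoeff n a * x ^ n := by
  rw [ordinaryHypergeometric_eq_tsum]
  simp only [smul_eq_mul, mwCoeff_eq_coeff, ordinaryHypergeometricCoefficient]

/-- Leibniz rule: `t_n` is differentiable in `a > 0` with derivative `mwCoeffDeriv n a`. [folklore] -/
theorem hasDerivAt_mwCoeff (n : ℕ) {a : ℝ} (ha : 0 < a) :
    HasDerivAt (mwCoeff n) (mwCoeffDeriv n a) a := by
  have h : ∀ i ∈ range n, HasDerivAt (mwRatio i) (mwRatioDeriv i a) a :=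
    fun i _ => hasDerivAt_mwRatio i (by positivity)
  exact HasDerivAt.fun_finsetProd h

/-- `|t_n(a)| ≤ 1` for `a ∈ (1/2, 3/2)`. [folklore] -/
theorem abs_mwCoeff_le_one (n : ℕ) {a : ℝ} (ha : a ∈ Ioo (1 / 2 : ℝ) (3 / 2)) :
    |mwCoeff n a| ≤ 1 := by
  rw [mwCoeff, abs_prod]
  exact prod_le_one (fun i _ => abs_nonneg _) fun i _ => abs_mwRatio_le_one i ha

/-- `|t_n'(a)| ≤ 4n` for `a ∈ (1/2, 3/2)`. [folklore] -/
theorem abs_mwCoeffDeriv_le (n : ℕ) {a : ℝ} (ha : a ∈ Ioo (1 / 2 : ℝ) (3 / 2)) :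
    |mwCoeffDeriv n a| ≤ 4 * n := by
  rw [mwCoeffDeriv]
  calc |∑ i ∈ range n, (∏ j ∈ (range n).erase i, mwRatio j a) • mwRatioDeriv i a|
      ≤ ∑ i ∈ range n, |(∏ j ∈ (range n).erase i, mwRatio j a) • mwRatioDeriv i a| :=
        abs_sum_le_sum_abs _ _
    _ ≤ ∑ _i ∈ range n, (4 : ℝ) := by
        refine sum_le_sum fun i _ => ?_
        rw [smul_eq_mul, abs_mul, abs_prod]
        have h1 : ∏ j ∈ (range n).erase i, |mwRatio j a| ≤ 1 :=
          prod_le_one (fun j _ => abs_nonneg _) fun j _ => abs_mwRatio_le_one j ha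
        have h2 := abs_mwRatioDeriv_le i ha
        have h3 : 0 ≤ ∏ j ∈ (range n).erase i, |mwRatio j a| :=
          prod_nonneg fun j _ => abs_nonneg _
        nlinarith [abs_nonneg (mwRatioDeriv i a)]
    _ = 4 * n := by rw [sum_const, card_range, nsmul_eq_mul]; ring

/-! ### Term-wise differentiation in the parameter -/

/-- **Parameter-derivative of the Miller–Werner hypergeometric factor.** For `|x| < 1` the map
`a ↦ ₂F₁(a, 1-a; 2a; x)` is differentiable on `(1/2, 3/2)` (i.e. `κ = 4/a ∈ (8/3, 8)`), with
derivative the term-wise differentiated Gauss series. [folklore] -/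
theorem hasDerivAt_hypergeometric_mwParam {x : ℝ} (hx : |x| < 1) {a : ℝ}
    (ha : a ∈ Ioo (1 / 2 : ℝ) (3 / 2)) :
    HasDerivAt (fun a => ₂F₁ a (1 - a) (2 * a) x) (∑' n : ℕ, mwCoeffDeriv n a * x ^ n) a := by
  have hfun : (fun a : ℝ => ₂F₁ a (1 - a) (2 * a) x) = fun a => ∑' n : ℕ, mwCoeff n a * x ^ n :=
    funext fun a => hypergeometric_mw_eq_tsum a x
  rw [hfun]
  have hx' : ‖|x|‖ < 1 := by rwa [Real.norm_eq_abs, abs_abs]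
  have hu : Summable fun n : ℕ => 4 * ((n : ℝ) ^ 1 * |x| ^ n) :=
    (summable_pow_mul_geometric_of_norm_lt_one 1 hx').mul_left 4
  refine hasDerivAt_tsum_of_isPreconnected hu isOpen_Ioo (convex_Ioo _ _).isPreconnected
    (fun n y hy => (hasDerivAt_mwCoeff n (by linarith [hy.1] : (0 : ℝ) < y)).mul_const (x ^ n))
    (fun n y hy => ?_) (by norm_num : (1 : ℝ) ∈ Ioo (1 / 2 : ℝ) (3 / 2)) ?_ ha
  · rw [Real.norm_eq_abs, abs_mul, abs_pow, pow_one]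
    have := abs_mwCoeffDeriv_le n hy
    have hxn : 0 ≤ |x| ^ n := pow_nonneg (abs_nonneg x) n
    nlinarith
  · refine Summable.of_norm_bounded (summable_geometric_of_lt_one (abs_nonneg x) hx) fun n => ?_
    rw [Real.norm_eq_abs, abs_mul, abs_pow]
    exact mul_le_of_le_one_left (pow_nonneg (abs_nonneg x) n)
      (abs_mwCoeff_le_one n (by norm_num))

/-- `κ`-form: for `x ∈ (-1, 1)` and `κ ∈ (8/3, 8)` the Miller–Werner factor
`κ ↦ f_κ(x) = ₂F₁(4/κ, 1-4/κ; 8/κ; x)` is differentiable at `κ`. [folklore] -/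
theorem differentiableAt_hypergeometric_mw {x : ℝ} (hx : |x| < 1) {κ : ℝ}
    (hκ : κ ∈ Ioo (8 / 3 : ℝ) 8) :
    DifferentiableAt ℝ (fun κ : ℝ => ₂F₁ (4 / κ) (1 - 4 / κ) (8 / κ) x) κ := by
  have hκ0 : 0 < κ := by linarith [hκ.1]
  have hfun : (fun κ : ℝ => ₂F₁ (4 / κ) (1 - 4 / κ) (8 / κ) x) =
      (fun a : ℝ => ₂F₁ a (1 - a) (2 * a) x) ∘ fun κ : ℝ => 4 / κ := by
    funext κ
    simp only [Function.comp_apply]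
    congr 1
    ring
  rw [hfun]
  have ha : 4 / κ ∈ Ioo (1 / 2 : ℝ) (3 / 2) := by
    constructor
    · rw [lt_div_iff₀ hκ0]; linarith [hκ.2]
    · rw [div_lt_iff₀ hκ0]; linarith [hκ.1]
  refine DifferentiableAt.comp κ (hasDerivAt_hypergeometric_mwParam hx ha).differentiableAt ?_
  exact (differentiableAt_const _).div differentiableAt_id hκ0.ne'

end Literature.Probability.RandomPlanarGeometry
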